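import Summits.AtomisticToContinuum.Crystallization.Theorems.PricedLinkCensusTruncatedCensusGapBarlowWindowLink

/-!
# The link dictionary of an affinely strained ideal Barlow stacking

Stub `stub_strainedLinkDictionary` (T1) of the line `elastic-basin-split` for the crux
`PricedLinkCensus.TruncatedCensusGap` (item stmt-AtomisticToContinuum-14230). The final theorem
below is the registered signature VERBATIM (self-contained over tree declarations).

## What

For a Hägg word `s`, the IDEAL close-packed stacking `S = barlowStacking 1 √(2/3) s` (in-layer
spacing `1`, layer spacing `√(2/3)`), a point `z₀ ∈ S` and a continuous linear
`F : ℝ³ →L[ℝ] ℝ³` with `‖F v − a₀ • v‖ ≤ (a₀ / 10) ‖v‖`, `a₀ = 977/1000`: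

1. every `z ∈ S`, `z ≠ z₀` has strained length `‖F (z − z₀)‖ ≥ 0.8793`;
2. "near in the strained picture" (`‖F (z − z₀)‖ < 1.231`) forces the ideal distance
   `dist z z₀ = 1` and the strained length `≤ 1.0747`;
3. there are exactly twelve near points;
4. a near pair `z₀, z` has exactly four common near points.

## Method

Pure bookkeeping on top of the landed `stub_barlowWindowLink` at `a = 1`, `c = √(2/3)`
(window check `0.81 ≤ √(2/3) ≤ 0.85`, i.e. `0.6561 ≤ 2/3 ≤ 0.7225`), where the adjacent-layer
distance is `√(1²/3 + (√(2/3))²) = √1 = 1`: every point of `S ∖ {z₀}` closer than `7/5` to `z₀` is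
at distance exactly `1`, there are twelve of them, and a near pair has four common near points
(`sld_idealLink`). The norm sandwich `0.8793 ‖v‖ ≤ ‖F v‖ ≤ 1.0747 ‖v‖` (`sld_le_norm`,
`sld_norm_le`) then gives the pointwise dictionary `sld_pointwise`:
`‖F (z − c)‖ < 1.231 ↔ dist z c < 7/5` for `z ≠ c` in `S`, so the strained near sets in (3), (4)
are literally the ideal near sets of the window link.

## Margin ledger (exact in `ℚ`)

* sandwich constants `977/1000 ∓ 977/10000 = 8793/10000, 10747/10000`;
* far points: `dist ≥ 7/5` gives `‖F (z − z₀)‖ ≥ 8793/10000 · 7/5 = 1.23102 ≥ 1.231`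
  (margin `2 · 10⁻⁵`);
* near points: `dist = 1` gives `‖F (z − z₀)‖ ≤ 1.0747 < 1.231` (margin `0.1563`);
* separation: every `z ≠ z₀` in `S` has `dist z z₀ ≥ 1`, hence `‖F (z − z₀)‖ ≥ 0.8793`.
-/

noncomputable section

namespace Summit.AtomisticToContinuum.Crystallization.Theorems.PricedLinkCensusTruncatedCensusGap

open Literature.MathematicalPhysics.StatisticalMechanics

section StrainedLinkDictionary

variable {F : EuclideanSpace ℝ (Fin 3) →L[ℝ] EuclideanSpace ℝ (Fin 3)} {s : ℤ → ℤ}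

/-- **Upper norm sandwich**: `‖F v‖ ≤ 1.0747 ‖v‖` whenever `‖F v − 0.977 • v‖ ≤ 0.0977 ‖v‖`
(triangle inequality). [folklore] -/
theorem sld_norm_le
    (hF : ∀ v : EuclideanSpace ℝ (Fin 3), ‖F v - (977 / 1000 : ℝ) • v‖ ≤ 977 / 10000 * ‖v‖)
    (v : EuclideanSpace ℝ (Fin 3)) : ‖F v‖ ≤ 10747 / 10000 * ‖v‖ := by
  have h1 := hF v
  have h2 : ‖(977 / 1000 : ℝ) • v‖ = 977 / 1000 * ‖v‖ := by
    rw [norm_smul, Real.norm_of_nonneg (by norm_num)]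
  have h3 := norm_sub_norm_le (F v) ((977 / 1000 : ℝ) • v)
  linarith

/-- **Lower norm sandwich**: `0.8793 ‖v‖ ≤ ‖F v‖` whenever `‖F v − 0.977 • v‖ ≤ 0.0977 ‖v‖`
(reverse triangle inequality). [folklore] -/
theorem sld_le_norm
    (hF : ∀ v : EuclideanSpace ℝ (Fin 3), ‖F v - (977 / 1000 : ℝ) • v‖ ≤ 977 / 10000 * ‖v‖)
    (v : EuclideanSpace ℝ (Fin 3)) : 8793 / 10000 * ‖v‖ ≤ ‖F v‖ := by
  have h1 := hF v
  have h2 : ‖(977 / 1000 : ℝ) • v‖ = 977 / 1000 * ‖v‖ := by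
    rw [norm_smul, Real.norm_of_nonneg (by norm_num)]
  have h3 := norm_sub_norm_le ((977 / 1000 : ℝ) • v) (F v)
  rw [← norm_sub_rev (F v)] at h3
  linarith

/-- **The ideal adjacent-layer distance is `1`**: `√(1²/3 + (√(2/3))²) = 1`. [folklore] -/
theorem sld_sqrt_adjLayer_eq_one :
    Real.sqrt ((1 : ℝ) ^ 2 / 3 + Real.sqrt (2 / 3) ^ 2) = 1 := by
  rw [Real.sq_sqrt (by norm_num), Real.sqrt_eq_one]
  norm_num

/-- **Ideal window link** — `stub_barlowWindowLink` at `a = 1`, `c = √(2/3)` (inside the window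
`0.81 ≤ c ≤ 0.85`): in `S = barlowStacking 1 √(2/3) s`, every point other than `z₀` closer than
`7/5` to `z₀` is at distance exactly `1`; there are twelve of them; and a near pair has exactly four
common near points. [folklore] -/
theorem sld_idealLink (hs : IsHaggSeq s) {z₀ : EuclideanSpace ℝ (Fin 3)}
    (hz₀ : z₀ ∈ barlowStacking 1 (Real.sqrt (2 / 3)) s) :
    (∀ z ∈ barlowStacking 1 (Real.sqrt (2 / 3)) s, z ≠ z₀ → dist z z₀ < 7 / 5 →
        dist z z₀ = 1) ∧
      {z ∈ barlowStacking 1 (Real.sqrt (2 / 3)) s | z ≠ z₀ ∧ dist z z₀ < 7 / 5}.ncard = 12 ∧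
      (∀ z ∈ barlowStacking 1 (Real.sqrt (2 / 3)) s, z ≠ z₀ → dist z z₀ < 7 / 5 →
        {w ∈ barlowStacking 1 (Real.sqrt (2 / 3)) s | w ≠ z₀ ∧ w ≠ z ∧ dist w z₀ < 7 / 5 ∧
            dist w z < 7 / 5}.ncard = 4) := by
  have hc1 : 81 / 100 * (1 : ℝ) ≤ Real.sqrt (2 / 3) := by
    rw [mul_one, Real.le_sqrt (by norm_num) (by norm_num)]
    norm_num
  have hc2 : Real.sqrt (2 / 3) ≤ 17 / 20 * (1 : ℝ) := by
    rw [mul_one, Real.sqrt_le_left (by norm_num)]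
    norm_num
  have h := stub_barlowWindowLink 1 (Real.sqrt (2 / 3)) s one_pos hc1 hc2 hs z₀ hz₀
  rw [mul_one, sld_sqrt_adjLayer_eq_one] at h
  obtain ⟨h1, h2, h3⟩ := h
  exact ⟨fun z hz hne hlt => (h1 z hz hne hlt).elim id id, h2, h3⟩

/-- **Pointwise dictionary.** For `c, z ∈ S = barlowStacking 1 √(2/3) s`, `z ≠ c`, and `F` in the
`10 %` basin around `0.977 • id`: the strained length `‖F (z − c)‖` is `≥ 0.8793`; if it is
`< 1.231` then `dist z c = 1` and it is `≤ 1.0747`; and it is `< 1.231` iff `dist z c < 7/5`.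
[folklore] -/
theorem sld_pointwise (hs : IsHaggSeq s)
    (hF : ∀ v : EuclideanSpace ℝ (Fin 3), ‖F v - (977 / 1000 : ℝ) • v‖ ≤ 977 / 10000 * ‖v‖)
    {c z : EuclideanSpace ℝ (Fin 3)} (hc : c ∈ barlowStacking 1 (Real.sqrt (2 / 3)) s)
    (hz : z ∈ barlowStacking 1 (Real.sqrt (2 / 3)) s) (hne : z ≠ c) :
    (8793 / 10000 : ℝ) ≤ ‖F (z - c)‖ ∧
      (‖F (z - c)‖ < 1231 / 1000 → dist z c = 1 ∧ ‖F (z - c)‖ ≤ 10747 / 10000) ∧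
      (‖F (z - c)‖ < 1231 / 1000 ↔ dist z c < 7 / 5) := by
  have hd : dist z c = ‖z - c‖ := dist_eq_norm z c
  have hlo := sld_le_norm hF (z - c)
  have hhi := sld_norm_le hF (z - c)
  rw [← hd] at hlo hhi
  have hnear := (sld_idealLink hs hc).1 z hz hne
  by_cases hlt : dist z c < 7 / 5
  · have h1 : dist z c = 1 := hnear hlt
    rw [h1] at hlo hhi
    have hlt' : ‖F (z - c)‖ < 1231 / 1000 := by linarith
    exact ⟨by linarith, fun _ => ⟨h1, by linarith⟩, iff_of_true hlt' hlt⟩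
  · have hge : 7 / 5 ≤ dist z c := not_lt.1 hlt
    have hfar : ¬ ‖F (z - c)‖ < 1231 / 1000 := fun hcon => by linarith
    exact ⟨by linarith, fun h => absurd h hfar, iff_of_false hfar hlt⟩

end StrainedLinkDictionary

/-- **Strained link dictionary** (registered stub `stub_strainedLinkDictionary`, T1 of the line
`elastic-basin-split`). For a Hägg word `s`, a continuous linear `F` with
`‖F v − 0.977 • v‖ ≤ 0.0977 ‖v‖`, and `z₀` in the ideal stacking `S = barlowStacking 1 √(2/3) s`:
(1) `‖F (z − z₀)‖ ≥ 0.8793` for `z ≠ z₀` in `S`; (2) `‖F (z − z₀)‖ < 1.231` forces `dist z z₀ = 1`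
and `‖F (z − z₀)‖ ≤ 1.0747`; (3) exactly twelve `z` have `‖F (z − z₀)‖ < 1.231`; (4) each of them
has exactly four common near points with `z₀`. Bookkeeping over `stub_barlowWindowLink`
(Hales, *Dense Sphere Packings* §1.3, cubocta/anticubocta links). [folklore] -/
theorem stub_strainedLinkDictionary :
    ∀ (s : ℤ → ℤ) (F : EuclideanSpace ℝ (Fin 3) →L[ℝ] EuclideanSpace ℝ (Fin 3)), Literature.MathematicalPhysics.StatisticalMechanics.IsHaggSeq s → (∀ v : EuclideanSpace ℝ (Fin 3), ‖F v - (977 / 1000 : ℝ) • v‖ ≤ 977 / 10000 * ‖v‖) → ∀ z₀ ∈ Literature.MathematicalPhysics.StatisticalMechanics.barlowStacking 1 (Real.sqrt (2 / 3)) s, (∀ z ∈ Literature.MathematicalPhysics.StatisticalMechanics.barlowStacking 1 (Real.sqrt (2 / 3)) s, z ≠ z₀ → (8793 / 10000 : ℝ) ≤ ‖F (z - z₀)‖) ∧ (∀ z ∈ Literature.MathematicalPhysics.StatisticalMechanics.barlowStacking 1 (Real.sqrt (2 / 3)) s, z ≠ z₀ → ‖F (z - z₀)‖ < 1231 / 1000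 → dist z z₀ = 1 ∧ ‖F (z - z₀)‖ ≤ 10747 / 10000) ∧ {z ∈ Literature.MathematicalPhysics.StatisticalMechanics.barlowStacking 1 (Real.sqrt (2 / 3)) s | z ≠ z₀ ∧ ‖F (z - z₀)‖ < 1231 / 1000}.ncard = 12 ∧ (∀ z ∈ Literature.MathematicalPhysics.StatisticalMechanics.barlowStacking 1 (Real.sqrt (2 / 3)) s, z ≠ z₀ → ‖F (z - z₀)‖ < 1231 / 1000 → {w ∈ Literature.MathematicalPhysics.StatisticalMechanics.barlowStacking 1 (Real.sqrt (2 / 3)) s | w ≠ z₀ ∧ w ≠ z ∧ ‖F (w - z₀)‖ < 1231 / 1000 ∧ ‖F (w - z)‖ < 1231 / 1000}.ncard = 4) := by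
  intro s F hs hF z₀ hz₀
  obtain ⟨-, h12, h4⟩ := sld_idealLink hs hz₀
  refine ⟨fun z hz hne => (sld_pointwise hs hF hz₀ hz hne).1,
    fun z hz hne => (sld_pointwise hs hF hz₀ hz hne).2.1, ?_, fun z hz hne hlt => ?_⟩
  · have hset :
        {z ∈ barlowStacking 1 (Real.sqrt (2 / 3)) s | z ≠ z₀ ∧ ‖F (z - z₀)‖ < 1231 / 1000} =
          {z ∈ barlowStacking 1 (Real.sqrt (2 / 3)) s | z ≠ z₀ ∧ dist z z₀ < 7 / 5} := by
      ext z
      simp only [Set.mem_setOf_eq]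
      constructor
      · rintro ⟨hz, hne, hlt⟩
        exact ⟨hz, hne, (sld_pointwise hs hF hz₀ hz hne).2.2.1 hlt⟩
      · rintro ⟨hz, hne, hlt⟩
        exact ⟨hz, hne, (sld_pointwise hs hF hz₀ hz hne).2.2.2 hlt⟩
    rw [hset]
    exact h12
  · have hzn : dist z z₀ < 7 / 5 := (sld_pointwise hs hF hz₀ hz hne).2.2.1 hlt
    have hset :
        {w ∈ barlowStacking 1 (Real.sqrt (2 / 3)) s | w ≠ z₀ ∧ w ≠ z ∧
            ‖F (w - z₀)‖ < 1231 / 1000 ∧ ‖F (w - z)‖ < 1231 / 1000} =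
          {w ∈ barlowStacking 1 (Real.sqrt (2 / 3)) s | w ≠ z₀ ∧ w ≠ z ∧ dist w z₀ < 7 / 5 ∧
            dist w z < 7 / 5} := by
      ext w
      simp only [Set.mem_setOf_eq]
      constructor
      · rintro ⟨hw, h0, h1, h2, h3⟩
        exact ⟨hw, h0, h1, (sld_pointwise hs hF hz₀ hw h0).2.2.1 h2,
          (sld_pointwise hs hF hz hw h1).2.2.1 h3⟩
      · rintro ⟨hw, h0, h1, h2, h3⟩
        exact ⟨hw, h0, h1, (sld_pointwise hs hF hz₀ hw h0).2.2.2 h2,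
          (sld_pointwise hs hF hz hw h1).2.2.2 h3⟩
    rw [hset]
    exact h4 z hz hne hzn

end Summit.AtomisticToContinuum.Crystallization.Theorems.PricedLinkCensusTruncatedCensusGap

end
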